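import Literature.NumberTheory.EllipticCurves.SkinnerUrban2014.SemistableCurvesProofs
import Literature.NumberTheory.DiophantineGeometry.GeneralizedFermatTwoPowerCoefficientSerreWeightProofs
import Literature.NumberTheory.GaloisRepresentations.SerreWeightBoundsProofs
import Mathlib.NumberTheory.ModularForms.LevelOne.DimensionFormula
import HarnessLib

/-!
# A semistable curve with irreducible `E[p]` that is peu ramifié at a multiplicative `p` has a
# second multiplicative prime ramified in `E[p]` (level-lowering to level one)

For a SEMISTABLE elliptic curve `E/ℚ`, an odd prime `p` of MULTIPLICATIVE reduction with
`p ∣ ord_p(Δ_min)` (i.e. `E[p]` is finite flat / peu ramifié at `p`) and `E[p]` irreducible, there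
is a prime `ℓ ‖ N`, `ℓ ≠ p`, with `p ∤ ord_ℓ(Δ_min)` — hypothesis (ram) of Skinner–Urban 2014 /
Skinner 2016.  Proof (Ribet's level-lowering argument, exactly as in the good-reduction case
`SkinnerUrban2014.ram_of_semistable_of_irr` of `SemistableCurvesProofs.lean`, lit-su gen 4): if
every `ℓ ‖ N`, `ℓ ≠ p`, had `p ∣ ord_ℓ(Δ_min)`, then `ρ̄ = E[p] ⊗ 𝔽̄_p` — irreducible, odd, modular —
would have Serre level `N(ρ̄) = 1` (Tate curve at every `ℓ ≠ p`) and Serre weight `k(ρ̄) = 2`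
(Tate curve at `p` with `p ∣ ord_p(Δ_min)`: shape `(χ *; 0 1)` and peu ramifié — the multiplicative
branch of the tree's `serreWeight_eq_two_of_isSemistableAt_of_dvd_ordMinimalDiscriminant`, whose
`5 ≤ p` is only used as `p ≠ 2`), so by Ribet 1990 / Diamond 1995 (`diamond1995_refinedSerre`,
published named fact) `ρ̄` would arise from a newform of weight `2` and level `M ∣ 1` — impossible
(`false_of_isGaloisRepOfNewform1Int_of_dvd_eight_of_ne_two`).  The très ramifié case
(`p ∤ ord_p(Δ_min)`, Serre weight `p + 1`) is NOT treated here: at `p ∈ {3, 5, 7}` it would need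
`S_{p+1}(SL₂(ℤ)) = 0` in the tree's newform language; at `p = 11` it fails (`X₀(11)`: `E[11] ≅ Δ mod 11`,
no second bad prime).

Consequence for the cell `b2b-bsdres` (RESIDUAL-MAP.md §C / §S.2, class X11a; kernel corollaries on the Summits side, `Partition/CornersThreeSemistable.lean`): on SEMISTABLE curves
the rank-`0` multiplicative corner X11a (`p ‖ N`, `E[p]` irreducible, NO (ram) witness) is confined
to the très ramifié locus `p ∤ ord_p(Δ_min)`; data check (rmap-3 g4, Cremona `N < 5·10⁵`, curve 1 of
every semistable class, 1.81·10⁶ (class, p) pairs with `p` odd, `p ‖ N`): 0 exceptions, and at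
`p ∈ {3, 5, 7}` every irreducible pair has (ram) (298 932 / 208 769 / 155 218), the first (ram)-free
irreducible semistable pairs being `11a1 @ 11`, `17a1 @ 17`, `19a1 @ 19`, `37a1 @ 37`.

No new definition, no named fact.  Binders: Modularity (`exists_isNewformOf`) and level-lowering
(`diamond1995_refinedSerre`), both published and already used by `SemistableCurvesProofs.lean`.

References: [Ribet1990] K. A. Ribet, Invent. Math. 100 (1990), Thm. 1.1; [Diamond1995RefinedSerre]
F. Diamond, Invent. Math. 121 (1995), Thm. 1.1; [Serre1987] J.-P. Serre, Duke Math. J. 54 (1987),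
§2.8 Prop. 3–4, (2.8.2)–(2.8.3), §4.1 (4.1.12); [SkinnerUrban2014] C. Skinner, E. Urban, Invent.
Math. 195 (2014), remark before Cor. 3.6.10 (p. 45) (the good-reduction case); [Skinner2016PacificMC]
C. Skinner, Pacific J. Math. 283 (2016), Thm. C (where (ram) is the hypothesis discharged here).
-/

noncomputable section

open scoped Classical MatrixGroups ModularForm NumberField
open CongruenceSubgroup Polynomial

namespace Literature.NumberTheory.EllipticCurves

open _root_.WeierstrassCurve GaloisRepresentations EllipticCurves.ModularForms
  Rat.HeightOneSpectrum IsDedekindDomain IsDedekindDomain.HeightOneSpectrum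
  Literature.NumberTheory.Automorphic Literature.NumberTheory.Automorphic.BCDT
  Literature.NumberTheory.DiophantineGeometry Literature.NumberTheory.EllipticCurves.Rank1Residual
  GaloisRepresentations.ModPGaloisRep GaloisRepresentations.IsNonarchimedeanLocalField
  Literature.NumberTheory.EllipticCurves.SkinnerUrban2014

section Ribet

open ValuativeRel

/-- **Serre's weight of `E[p] ⊗ k` is `2` at an odd prime `p` of MULTIPLICATIVE reduction with
`p ∣ ord_p(Δ_min)`**, at the canonical local datum `(ℚ_v, ρ̄'|Γ_{ℚ_v})`: the multiplicative branch of
`serreWeight_eq_two_of_isSemistableAt_of_dvd_ordMinimalDiscriminant` with `5 ≤ p` relaxed to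
`p ≠ 2` — shape `(ψ₁ *; 0 1)` (`hasLevelOneInertiaShape_restrictField_of_hasMultiplicativeReductionAt`)
and peu ramifié (`isPeuRamifie_restrictField_of_hasMultiplicativeReductionAt_of_dvd`), then
`serreWeight_eq_two_of_shape`.
[cite: Serre1987, §2.8 Prop. 4, (2.8.3); §2.9 Prop. 5] -/
theorem serreWeight_eq_two_of_hasMultiplicativeReductionAt_of_dvd (W : WeierstrassCurve ℚ)
    [W.IsElliptic] (p : ℕ) [hp : Fact p.Prime] (hp2 : p ≠ 2) (v : HeightOneSpectrum (𝓞 ℚ))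
    (hpv : (p : 𝓞 ℚ) ∈ v.asIdeal) (hmult : W.HasMultiplicativeReductionAt v)
    (hpord : p ∣ W.ordMinimalDiscriminant v) {ρ : ModPGaloisRep ℚ (ZMod p) 2}
    (hρ : W.IsTorsionGaloisRep p ρ) (k : Type) [Field k] [TopologicalSpace k] [DiscreteTopology k]
    (j : ZMod p →+* k)
    (ι : absIntegers 𝒪[v.adicCompletion ℚ] (v.adicCompletion ℚ) ⧸
      absMaximalIdeal (v.adicCompletion ℚ) →+* k) :
    serreWeight p (FramedRep.baseChange j continuous_of_discreteTopology ρ)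
      { F := v.adicCompletion ℚ
        residueFieldCard_eq := residueFieldCard_adicCompletion_eq_of_natCast_mem hpv
        irreducible_natCast := irreducible_natCast_valuativeInteger_adicCompletion_of_natCast_mem hpv
        rep := FramedGaloisRep.restrictField (v.adicCompletion ℚ)
          (FramedRep.baseChange j continuous_of_discreteTopology ρ)
        rep_eq_restrictField := rfl } ι = 2 := by
  haveI : ContinuousAdd k := ⟨continuous_of_discreteTopology⟩
  haveI : ContinuousMul k := ⟨continuous_of_discreteTopology⟩
  haveI : ContinuousNeg k := ⟨continuous_of_discreteTopology⟩
  haveI : IsTopologicalSemiring k := ⟨⟩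
  haveI : IsTopologicalRing k := ⟨⟩
  have hirr : Irreducible ((p : ℕ) : 𝒪[v.adicCompletion ℚ]) :=
    irreducible_natCast_valuativeInteger_adicCompletion_of_natCast_mem hpv
  have hq : residueFieldCard (v.adicCompletion ℚ) = p :=
    residueFieldCard_adicCompletion_eq_of_natCast_mem hpv
  have hgen := natCast_dvd_of_mem_maximalIdeal_adicCompletionIntegers (v := v) hpv
  refine serreWeight_eq_two_of_shape _ _ hp2 ?_
  change ModPGaloisRep.HasLevelTwoInertiaShape (FramedGaloisRep.restrictField (v.adicCompletion ℚ)
      (FramedRep.baseChange j continuous_of_discreteTopology ρ)) ι ((p : ℕ) : 𝒪[v.adicCompletion ℚ])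
      hirr 0 1 ∨
    (ModPGaloisRep.HasLevelOneInertiaShape (FramedGaloisRep.restrictField (v.adicCompletion ℚ)
      (FramedRep.baseChange j continuous_of_discreteTopology ρ)) ι ((p : ℕ) : 𝒪[v.adicCompletion ℚ])
      hirr 1 0 ∧
     (ModPGaloisRep.IsTamelyRamified (FramedGaloisRep.restrictField (v.adicCompletion ℚ)
        (FramedRep.baseChange j continuous_of_discreteTopology ρ)) ∨
      ModPGaloisRep.IsPeuRamifie (FramedGaloisRep.restrictField (v.adicCompletion ℚ)
        (FramedRep.baseChange j continuous_of_discreteTopology ρ))))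
  exact Or.inr ⟨W.hasLevelOneInertiaShape_restrictField_of_hasMultiplicativeReductionAt hp2 hpv hmult
    hρ j _ hirr hq ι,
    Or.inr (W.isPeuRamifie_restrictField_of_hasMultiplicativeReductionAt_of_dvd p hp2 v hpv hmult
      hpord hgen hirr hρ j _)⟩

/-- **(ram) for a semistable curve at a peu ramifié multiplicative odd prime.**  `E/ℚ` semistable,
`p` odd, `E` multiplicative at `p` with `p ∣ ord_p(Δ_min)`, `E[p]` irreducible ⇒ some `ℓ ‖ N`,
`ℓ ≠ p`, has `p ∤ ord_ℓ(Δ_min)` (the mod-`p` representation is ramified at `ℓ`).  Ribet's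
level-lowering-to-level-one argument; see the module docstring.
[cite: Ribet1990, Thm. 1.1] [cite: Diamond1995RefinedSerre, Thm. 1.1]
[cite: Serre1987, §2.8 Prop. 4, (2.8.3), §4.1 (4.1.12)] -/
theorem ram_of_semistable_of_irr_of_mult_of_dvd (hmod : exists_isNewformOf)
    (hLL : diamond1995_refinedSerre) (W : WeierstrassCurve ℚ) [W.IsElliptic] [W.IsGloballyMinimal]
    (p : ℕ) [Fact p.Prime] (hp2 : p ≠ 2) (hmultp : Mult W p)
    (hpeu : p ∣ padicValInt p W.minimalDiscriminantInt) (hsst : Semistable W) (hirr : Irr W p) :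
    Ram W p := by
  classical
  have hp : p.Prime := Fact.out
  have hodd : Odd p := hp.odd_of_ne_two hp2
  have hsstZ : W.IsSemistable ℤ := (semistable_iff_isSemistable_int W).mp hsst
  -- `ord_u Δ_min = v_{ℓ}(Δ_min)` at every place `u` of `ℤ`
  have hordZ : ∀ u : HeightOneSpectrum ℤ,
      W.ordMinimalDiscriminant u = padicValInt (natGenerator u) W.minimalDiscriminantInt := by
    intro u
    rw [← W.factorization_minimalDiscriminantNorm_holds u,
      minimalDiscriminantNorm_int_eq_natAbs_minimalDiscriminantInt_holds W,
      Nat.factorization_def _ (show (natGenerator u).Prime from (primesEquiv u).2)]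
    rfl
  by_contra hram
  -- `¬ Ram`: at every multiplicative place `u ∤ p` of `ℤ`, `p ∣ ord_u Δ_min`
  have hunr : ∀ u : HeightOneSpectrum ℤ, natGenerator u ≠ p → W.HasMultiplicativeReductionAt u →
      p ∣ W.ordMinimalDiscriminant u := by
    intro u hup hmu
    by_contra hdiv
    apply hram
    refine ⟨natGenerator u, ⟨(primesEquiv u).2⟩, hup,
      (hasMultiplicativeReductionAtPrime_primesEquiv_iff_hasMultiplicativeReductionAt W u).mpr hmu,
      ?_⟩
    rwa [hordZ u] at hdiv
  /- Step 1. A framed model `ρ̄` of `E[p]` and `ρ̄' = ρ̄ ⊗ 𝔽̄_p`: irreducible and odd. -/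
  haveI : NeZero ((p : ℕ) : ℚ) := ⟨by exact_mod_cast hp.ne_zero⟩
  obtain ⟨ρ, hρ⟩ := W.exists_isTorsionGaloisRep p
  letI : TopologicalSpace (AlgebraicClosure (ZMod p)) := ⊥
  haveI : DiscreteTopology (AlgebraicClosure (ZMod p)) := ⟨rfl⟩
  set j : ZMod p →+* AlgebraicClosure (ZMod p) := algebraMap (ZMod p) (AlgebraicClosure (ZMod p))
    with hj
  set ρ' : ModPGaloisRep ℚ (AlgebraicClosure (ZMod p)) 2 :=
    FramedRep.baseChange j continuous_of_discreteTopology ρ with hρ'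
  have habs := isAbsolutelyIrreducible_of_hasIrreducibleModPGaloisRep W hp2 hirr hρ
  have hirr' : ρ'.toGaloisRep.IsIrreducible := by
    rw [← ModPGaloisRep.isIrreducible_iff_toGaloisRep]
    exact habs.isIrreducible_baseChange (AlgebraicClosure (ZMod p)) j _
  have hodd' : FramedGaloisRep.IsOdd ρ' :=
    (ModPGaloisRep.isOdd_of_det_eq_modPCyclotomicCharacterZMod ρ
      (W.det_eq_modPCyclotomicCharacter_of_isTorsionGaloisRep_holds p ρ hρ)).baseChange j _
  /- Step 2. `ρ̄` and `ρ̄'` are modular, `E` being modular (`hmod`). -/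
  haveI : NeZero (W.conductorNorm ℤ) := ⟨(conductorNorm_pos_holds W).ne'⟩
  have hWmod : BCDT.IsModular W := exists_isNewformOf_iff.mp hmod W
  have hρmod : ModPGaloisRep.IsModular ρ := hWmod.isModular_of_isTorsionGaloisRep'' hρ
  have hρ'mod : ModPGaloisRep.IsModular ρ' := hρmod.baseChange_algebraicClosure
  /- Step 3. The canonical local datum at the place `v` above `p`; the weight is `2`
     (multiplicative, peu ramifié). -/
  obtain ⟨v, hv⟩ : ∃ v : HeightOneSpectrum (𝓞 ℚ), primesEquiv v = ⟨p, hp⟩ :=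
    ⟨(primesEquiv (R := 𝓞 ℚ)).symm ⟨p, hp⟩, Equiv.apply_symm_apply _ _⟩
  have hpv' : (p : 𝓞 ℚ) ∈ v.asIdeal := (natCast_mem_asIdeal_iff_primesEquiv_eq v hp).mpr (by rw [hv])
  have hvs : v = (primesEquiv (R := 𝓞 ℚ)).symm ⟨p, hp⟩ := by
    rw [Equiv.eq_symm_apply]; exact hv
  -- the place of `ℤ` above `p`
  set uZ : HeightOneSpectrum ℤ := (primesEquiv (R := ℤ)).symm ⟨p, hp⟩ with huZ
  have huZp : natGenerator uZ = p := Rat.natGenerator_primesEquiv_symm ⟨p, hp⟩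
  have hpe : (primesEquiv uZ : Nat.Primes) = ⟨p, hp⟩ := Equiv.apply_symm_apply _ _
  have hmultZ : W.HasMultiplicativeReductionAt uZ := by
    have h := hasMultiplicativeReductionAtPrime_primesEquiv_iff_hasMultiplicativeReductionAt W uZ
    rw [hpe] at h
    exact h.mp hmultp
  have hmultv : W.HasMultiplicativeReductionAt v := by
    rw [hvs]; exact hasMultiplicativeReductionAt_of_int W ⟨p, hp⟩ hmultZ
  have hpordv : p ∣ W.ordMinimalDiscriminant v := by
    rw [hvs, ordMinimalDiscriminant_eq_of_int, ← huZ, hordZ uZ, huZp]; exact hpeu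
  set loc : LocalRestrictionAt p ρ' :=
    { F := v.adicCompletion ℚ
      residueFieldCard_eq := residueFieldCard_adicCompletion_eq_of_natCast_mem hpv'
      irreducible_natCast := irreducible_natCast_valuativeInteger_adicCompletion_of_natCast_mem hpv'
      rep := FramedGaloisRep.restrictField (v.adicCompletion ℚ) ρ'
      rep_eq_restrictField := rfl } with hloc
  obtain ⟨ι⟩ := nonempty_ringHom_residue (k := AlgebraicClosure (ZMod p)) p (v.adicCompletion ℚ)
    (residueFieldCard_adicCompletion_eq_of_natCast_mem hpv')
  have hw : (serreWeight p ρ' loc ι : ℤ) = 2 := by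
    have h2 : serreWeight p ρ' loc ι = 2 :=
      serreWeight_eq_two_of_hasMultiplicativeReductionAt_of_dvd W p hp2 v hpv' hmultv hpordv hρ
        (AlgebraicClosure (ZMod p)) j ι
    rw [h2]; rfl
  /- Step 4. Level-lowering: `ρ̄'` arises from a newform `f` of weight `2` and level `M ∣ N(ρ̄')`. -/
  obtain ⟨M, hMz, hMN, f, ιf, hf, hgal⟩ :=
    hLL p hodd (AlgebraicClosure (ZMod p)) ρ' hirr' hodd' hρ'mod loc ι
  revert hgal hf ιf f
  rw [hw]
  intro f ιf hf hgal
  /- Step 5. `N(ρ̄') = 1`: no prime divides it. -/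
  have hN1 : serreLevel p ρ' = 1 := by
    refine Nat.eq_one_iff_not_exists_prime_dvd.mpr fun q hq hqN ↦ ?_
    rcases eq_or_ne q p with rfl | hqp
    · exact not_dvd_serreLevel q ρ' hqN
    · obtain ⟨u, hu⟩ : ∃ u : HeightOneSpectrum ℤ, natGenerator u = q :=
        ⟨(primesEquiv (R := ℤ)).symm ⟨q, hq⟩, Rat.natGenerator_primesEquiv_symm ⟨q, hq⟩⟩
      rcases hsstZ u with hgu | hmu
      · exact not_dvd_serreLevel_baseChange_of_hasGoodReductionAt_int W p hρ j _ u
          (by rw [hu]; exact hqp) hgu (by rw [hu]; exact hqN)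
      · exact not_dvd_serreLevel_baseChange_of_hasMultiplicativeReductionAt_of_dvd_int W p hρ j _ u
          (by rw [hu]; exact hqp) hmu (hunr u (by rw [hu]; exact hqp) hmu) (by rw [hu]; exact hqN)
  /- Step 6. A newform of weight `2` and level `M ∣ 1` carrying `E[p]`: impossible. -/
  haveI : NeZero M := hMz
  have hM8 : M ∣ 8 := (hN1 ▸ hMN).trans (one_dvd 8)
  exact false_of_isGaloisRepOfNewform1Int_of_dvd_eight_of_ne_two W hp2 hρ j hM8 hf ιf hgal

end Ribet


/-! ## `p = 3`: every semistable curve with irreducible `E[3]` satisfies (ram)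

At `p = 3` no très/peu ramifié analysis is needed: Serre's weight satisfies `2 ≤ k(ρ̄) ≤ p² − 1 = 8`
(`serreWeight_le_holds`, Serre 1987 n° 2.6) and `S_k(Γ₁(1)) = 0` for every `k < 12` (Mathlib,
`CuspForm.rank_eq_zero_of_weight_lt_twelve`, transported along `Γ₁(1) = SL₂(ℤ)`), so a semistable
curve with irreducible `E[3]` unramified at every `ℓ ≠ 3` would give a newform of level `1` and
weight `≤ 8` — impossible.  Hence (ram) holds at `3` for EVERY semistable curve with `E[3]`
irreducible — `3` good (lit-su's `SkinnerUrban2014.ram_of_semistable_of_irr` at `p = 3`), or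
multiplicative, très ramifié or not; the reduction type at `3` is not used.  Data (rmap-3 g4): 298 932 / 298 932 semistable Cremona classes
`N < 5·10⁵` with `3 ‖ N` and `E[3]` irreducible have a (ram) witness. -/

section LevelOne

/-- `Γ₁(1) = SL₂(ℤ)`. [folklore] -/
private theorem Gamma1_one_eq_top : CongruenceSubgroup.Gamma1 1 = ⊤ := by
  ext A
  simp only [CongruenceSubgroup.Gamma1_mem, Subgroup.mem_top, iff_true]
  exact ⟨Subsingleton.elim _ _, Subsingleton.elim _ _, Subsingleton.elim _ _⟩

/-- The `GL₂(ℝ)`-image of `Γ₁(1)` is `𝒮ℒ`. [folklore] -/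
private theorem Gamma1_one_coe_eq_SL :
    (↑(CongruenceSubgroup.Gamma1 1) : Subgroup (GL (Fin 2) ℝ)) = 𝒮ℒ := by
  rw [Gamma1_one_eq_top, ← CongruenceSubgroup.Gamma_one_top, CongruenceSubgroup.Gamma_one_coe_eq_SL]

/-- **`S_k(SL₂(ℤ)) = 0` for `k < 12`** (Mathlib's `CuspForm.rank_eq_zero_of_weight_lt_twelve`),
for any subgroup `Γ` that IS `𝒮ℒ`. [folklore] -/
private theorem cuspForm_eq_zero_of_eq_SL_of_lt_twelve {Γ : Subgroup (GL (Fin 2) ℝ)} (hΓ : Γ = 𝒮ℒ)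
    {k : ℤ} (hk : k < 12) (f : CuspForm Γ k) : f = 0 := by
  subst hΓ
  exact (rank_zero_iff_forall_zero.mp (CuspForm.rank_eq_zero_of_weight_lt_twelve hk)) f

/-- **`S_k(Γ₁(1)) = S_k(SL₂(ℤ)) = 0` for `k < 12`** — the level-one dimension formula
(`dim S_k(SL₂(ℤ)) = ⌊k/12⌋ − 1` if `k ≡ 2 (mod 12)`, else `⌊k/12⌋`, for even `k ≥ 4`; `0` for `k ≤ 2`
or `k` odd), here from Mathlib's `CuspForm.rank_eq_zero_of_weight_lt_twelve` (the `Δ`-isomorphism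
`S_k ≅ M_{k−12}`) transported along `Γ₁(1) = SL₂(ℤ)`.
[cite: DiamondShurman2005, Thm. 3.5.2] -/
theorem cuspForm_gamma1_one_eq_zero_of_lt_twelve {k : ℤ} (hk : k < 12)
    (f : CuspForm (CongruenceSubgroup.Gamma1 1) k) : f = 0 :=
  cuspForm_eq_zero_of_eq_SL_of_lt_twelve Gamma1_one_coe_eq_SL hk f

end LevelOne

section RibetThree

open ValuativeRel

/-- **(ram) at `3` for EVERY semistable curve with `E[3]` irreducible, whatever the reduction at `3`.**
`E/ℚ` semistable, `E[3]` irreducible ⇒ some `ℓ ‖ N`, `ℓ ≠ 3`, has `3 ∤ ord_ℓ(Δ_min)`.  Ribet's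
level-lowering to level one with Serre's bound `k(ρ̄) ≤ p² − 1 = 8 < 12` in place of any local
computation at `3` (so the good case of `SkinnerUrban2014.ram_of_semistable_of_irr` at `p = 3` and the
multiplicative case, peu OR très ramifié, are covered at once); see the section docstring.
[cite: Ribet1990, Thm. 1.1] [cite: Diamond1995RefinedSerre, Thm. 1.1]
[cite: Serre1987, §2.6 (2 ≤ k ≤ p² − 1), §4.1 (4.1.12)] -/
theorem ram_three_of_semistable_of_irr (hmod : exists_isNewformOf)
    (hLL : diamond1995_refinedSerre) (W : WeierstrassCurve ℚ) [W.IsElliptic] [W.IsGloballyMinimal]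
    (hsst : Semistable W) (hirr : Irr W 3) : Ram W 3 := by
  classical
  have hp : (3 : ℕ).Prime := Fact.out
  have hp2 : (3 : ℕ) ≠ 2 := by decide
  have hodd : Odd 3 := hp.odd_of_ne_two hp2
  have hsstZ : W.IsSemistable ℤ := (semistable_iff_isSemistable_int W).mp hsst
  have hordZ : ∀ u : HeightOneSpectrum ℤ,
      W.ordMinimalDiscriminant u = padicValInt (natGenerator u) W.minimalDiscriminantInt := by
    intro u
    rw [← W.factorization_minimalDiscriminantNorm_holds u,
      minimalDiscriminantNorm_int_eq_natAbs_minimalDiscriminantInt_holds W,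
      Nat.factorization_def _ (show (natGenerator u).Prime from (primesEquiv u).2)]
    rfl
  by_contra hram
  have hunr : ∀ u : HeightOneSpectrum ℤ, natGenerator u ≠ 3 → W.HasMultiplicativeReductionAt u →
      3 ∣ W.ordMinimalDiscriminant u := by
    intro u hup hmu
    by_contra hdiv
    apply hram
    refine ⟨natGenerator u, ⟨(primesEquiv u).2⟩, hup,
      (hasMultiplicativeReductionAtPrime_primesEquiv_iff_hasMultiplicativeReductionAt W u).mpr hmu,
      ?_⟩
    rwa [hordZ u] at hdiv
  /- Step 1. A framed model `ρ̄` of `E[3]` and `ρ̄' = ρ̄ ⊗ 𝔽̄_3`: irreducible and odd. -/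
  haveI : NeZero ((3 : ℕ) : ℚ) := ⟨by exact_mod_cast hp.ne_zero⟩
  obtain ⟨ρ, hρ⟩ := W.exists_isTorsionGaloisRep 3
  letI : TopologicalSpace (AlgebraicClosure (ZMod 3)) := ⊥
  haveI : DiscreteTopology (AlgebraicClosure (ZMod 3)) := ⟨rfl⟩
  set j : ZMod 3 →+* AlgebraicClosure (ZMod 3) := algebraMap (ZMod 3) (AlgebraicClosure (ZMod 3))
    with hj
  set ρ' : ModPGaloisRep ℚ (AlgebraicClosure (ZMod 3)) 2 :=
    FramedRep.baseChange j continuous_of_discreteTopology ρ with hρ'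
  have habs := isAbsolutelyIrreducible_of_hasIrreducibleModPGaloisRep W hp2 hirr hρ
  have hirr' : ρ'.toGaloisRep.IsIrreducible := by
    rw [← ModPGaloisRep.isIrreducible_iff_toGaloisRep]
    exact habs.isIrreducible_baseChange (AlgebraicClosure (ZMod 3)) j _
  have hodd' : FramedGaloisRep.IsOdd ρ' :=
    (ModPGaloisRep.isOdd_of_det_eq_modPCyclotomicCharacterZMod ρ
      (W.det_eq_modPCyclotomicCharacter_of_isTorsionGaloisRep_holds 3 ρ hρ)).baseChange j _
  /- Step 2. `ρ̄` and `ρ̄'` are modular. -/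
  haveI : NeZero (W.conductorNorm ℤ) := ⟨(conductorNorm_pos_holds W).ne'⟩
  have hWmod : BCDT.IsModular W := exists_isNewformOf_iff.mp hmod W
  have hρmod : ModPGaloisRep.IsModular ρ := hWmod.isModular_of_isTorsionGaloisRep'' hρ
  have hρ'mod : ModPGaloisRep.IsModular ρ' := hρmod.baseChange_algebraicClosure
  /- Step 3. The canonical local datum at the place above `3`; the weight is `≤ 8`. -/
  obtain ⟨v, hv⟩ : ∃ v : HeightOneSpectrum (𝓞 ℚ), primesEquiv v = ⟨3, hp⟩ :=
    ⟨(primesEquiv (R := 𝓞 ℚ)).symm ⟨3, hp⟩, Equiv.apply_symm_apply _ _⟩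
  have hpv' : ((3 : ℕ) : 𝓞 ℚ) ∈ v.asIdeal := (natCast_mem_asIdeal_iff_primesEquiv_eq v hp).mpr (by rw [hv])
  set loc : LocalRestrictionAt 3 ρ' :=
    { F := v.adicCompletion ℚ
      residueFieldCard_eq := residueFieldCard_adicCompletion_eq_of_natCast_mem hpv'
      irreducible_natCast := irreducible_natCast_valuativeInteger_adicCompletion_of_natCast_mem hpv'
      rep := FramedGaloisRep.restrictField (v.adicCompletion ℚ) ρ'
      rep_eq_restrictField := rfl } with hloc
  obtain ⟨ι⟩ := nonempty_ringHom_residue (k := AlgebraicClosure (ZMod 3)) 3 (v.adicCompletion ℚ)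
    (residueFieldCard_adicCompletion_eq_of_natCast_mem hpv')
  have hw8 : serreWeight 3 ρ' loc ι ≤ 8 := by
    have h := (serreWeight_le_holds 3 ρ' hp2 loc ι).2
    simpa using h
  have hw12 : ((serreWeight 3 ρ' loc ι : ℕ) : ℤ) < 12 := by omega
  /- Step 4. Level-lowering: `ρ̄'` arises from a newform of weight `k(ρ̄') ≤ 8` and level `M ∣ N(ρ̄')`. -/
  obtain ⟨M, hMz, hMN, f, ιf, hf, hgal⟩ :=
    hLL 3 hodd (AlgebraicClosure (ZMod 3)) ρ' hirr' hodd' hρ'mod loc ι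
  /- Step 5. `N(ρ̄') = 1`. -/
  have hN1 : serreLevel 3 ρ' = 1 := by
    refine Nat.eq_one_iff_not_exists_prime_dvd.mpr fun q hq hqN ↦ ?_
    rcases eq_or_ne q 3 with rfl | hqp
    · exact not_dvd_serreLevel 3 ρ' hqN
    · obtain ⟨u, hu⟩ : ∃ u : HeightOneSpectrum ℤ, natGenerator u = q :=
        ⟨(primesEquiv (R := ℤ)).symm ⟨q, hq⟩, Rat.natGenerator_primesEquiv_symm ⟨q, hq⟩⟩
      rcases hsstZ u with hgu | hmu
      · exact not_dvd_serreLevel_baseChange_of_hasGoodReductionAt_int W 3 hρ j _ u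
          (by rw [hu]; exact hqp) hgu (by rw [hu]; exact hqN)
      · exact not_dvd_serreLevel_baseChange_of_hasMultiplicativeReductionAt_of_dvd_int W 3 hρ j _ u
          (by rw [hu]; exact hqp) hmu (hunr u (by rw [hu]; exact hqp) hmu) (by rw [hu]; exact hqN)
  /- Step 6. `M = 1`, and `S_k(Γ₁(1)) = 0` for `k ≤ 8 < 12` — but a newform is nonzero. -/
  have hM1 : M = 1 := Nat.dvd_one.mp (hN1 ▸ hMN)
  subst hM1
  exact IsNormalized.ne_zero hf.2.2.2 (cuspForm_gamma1_one_eq_zero_of_lt_twelve hw12 f)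

end RibetThree


/-! ## `p ∈ {3, 5, 7}`: every semistable curve with irreducible `E[p]` satisfies (ram)

At a semistable odd prime `p` Serre's weight of `E[p] ⊗ 𝔽̄_p` is `2` (good reduction; or
multiplicative and peu ramifié / tame) or `p + 1` (multiplicative, très ramifié:
`serreWeightLocal_eq_residueFieldCard_add_one_holds`) — in every case `≤ p + 1`
(`serreWeight_le_succ_of_semistable`).  For `p ≤ 7` this is `< 12`, so the level-one argument of
the previous section applies verbatim: a semistable curve with `E[p]` irreducible and no (ram)
witness would give a newform on `SL₂(ℤ)` of weight `≤ 8`.  At `p = 11` the statement fails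
(`X₀(11)`: weight `12`, `E[11] ≅ Δ mod 11`).  Data (rmap-3 g4, Cremona `N < 5·10⁵`, semistable
classes, irreducible `E[p]`, `p ‖ N`): (ram) holds on 298 932 / 208 769 / 155 218 pairs at
`p = 3 / 5 / 7`, and fails first at `11a1 @ 11`. -/

section RibetSeven

open ValuativeRel

/-- **Serre's weight of `E[p] ⊗ k` at a SEMISTABLE odd `p` is at most `p + 1`** (canonical local
datum): `2` at a good `p` (`SkinnerUrban2014.serreWeight_eq_two_of_hasGoodReductionAt`) or at a
multiplicative peu ramifié `p` (`serreWeight_eq_two_of_shape`), `p + 1` at a multiplicative très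
ramifié `p` (`serreWeightLocal_eq_residueFieldCard_add_one_holds` on the Tate-curve shape
`(χ *; 0 1)`). [cite: Serre1987, §2.4 (ii), §2.8 Prop. 3–4, (2.8.2)–(2.8.3), §2.9 Prop. 5] -/
theorem serreWeight_le_succ_of_semistable (W : WeierstrassCurve ℚ) [W.IsElliptic] (p : ℕ)
    [hp : Fact p.Prime] (hp2 : p ≠ 2) (v : HeightOneSpectrum (𝓞 ℚ)) (hpv : (p : 𝓞 ℚ) ∈ v.asIdeal)
    (hsemi : W.HasGoodReductionAt v ∨ W.HasMultiplicativeReductionAt v)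
    {ρ : ModPGaloisRep ℚ (ZMod p) 2} (hρ : W.IsTorsionGaloisRep p ρ) (k : Type) [Field k]
    [TopologicalSpace k] [DiscreteTopology k] (j : ZMod p →+* k)
    (ι : absIntegers 𝒪[v.adicCompletion ℚ] (v.adicCompletion ℚ) ⧸
      absMaximalIdeal (v.adicCompletion ℚ) →+* k) :
    serreWeight p (FramedRep.baseChange j continuous_of_discreteTopology ρ)
      { F := v.adicCompletion ℚ
        residueFieldCard_eq := residueFieldCard_adicCompletion_eq_of_natCast_mem hpv
        irreducible_natCast := irreducible_natCast_valuativeInteger_adicCompletion_of_natCast_mem hpv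
        rep := FramedGaloisRep.restrictField (v.adicCompletion ℚ)
          (FramedRep.baseChange j continuous_of_discreteTopology ρ)
        rep_eq_restrictField := rfl } ι ≤ p + 1 := by
  rcases hsemi with hgood | hmult
  · rw [serreWeight_eq_two_of_hasGoodReductionAt W p hp2 v hpv hgood hρ k j ι]
    have := hp.out.two_le; omega
  haveI : ContinuousAdd k := ⟨continuous_of_discreteTopology⟩
  haveI : ContinuousMul k := ⟨continuous_of_discreteTopology⟩
  haveI : ContinuousNeg k := ⟨continuous_of_discreteTopology⟩
  haveI : IsTopologicalSemiring k := ⟨⟩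
  haveI : IsTopologicalRing k := ⟨⟩
  have hirr : Irreducible ((p : ℕ) : 𝒪[v.adicCompletion ℚ]) :=
    irreducible_natCast_valuativeInteger_adicCompletion_of_natCast_mem hpv
  have hq : residueFieldCard (v.adicCompletion ℚ) = p :=
    residueFieldCard_adicCompletion_eq_of_natCast_mem hpv
  have hq2 : residueFieldCard (v.adicCompletion ℚ) ≠ 2 := by rw [hq]; exact hp2
  have hshape : ModPGaloisRep.HasLevelOneInertiaShape (FramedGaloisRep.restrictField
      (v.adicCompletion ℚ) (FramedRep.baseChange j continuous_of_discreteTopology ρ)) ι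
      ((p : ℕ) : 𝒪[v.adicCompletion ℚ]) hirr 1 0 :=
    W.hasLevelOneInertiaShape_restrictField_of_hasMultiplicativeReductionAt hp2 hpv hmult hρ j _ hirr
      hq ι
  by_cases hpeu : ModPGaloisRep.IsPeuRamifie (FramedGaloisRep.restrictField (v.adicCompletion ℚ)
      (FramedRep.baseChange j continuous_of_discreteTopology ρ))
  · -- multiplicative, peu ramifié: weight 2
    have h2 : serreWeight p (FramedRep.baseChange j continuous_of_discreteTopology ρ)
        { F := v.adicCompletion ℚ
          residueFieldCard_eq := residueFieldCard_adicCompletion_eq_of_natCast_mem hpv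
          irreducible_natCast := irreducible_natCast_valuativeInteger_adicCompletion_of_natCast_mem hpv
          rep := FramedGaloisRep.restrictField (v.adicCompletion ℚ)
            (FramedRep.baseChange j continuous_of_discreteTopology ρ)
          rep_eq_restrictField := rfl } ι = 2 := by
      refine serreWeight_eq_two_of_shape _ _ hp2 ?_
      change ModPGaloisRep.HasLevelTwoInertiaShape (FramedGaloisRep.restrictField (v.adicCompletion ℚ)
          (FramedRep.baseChange j continuous_of_discreteTopology ρ)) ι
          ((p : ℕ) : 𝒪[v.adicCompletion ℚ]) hirr 0 1 ∨
        (ModPGaloisRep.HasLevelOneInertiaShape (FramedGaloisRep.restrictField (v.adicCompletion ℚ)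
          (FramedRep.baseChange j continuous_of_discreteTopology ρ)) ι
          ((p : ℕ) : 𝒪[v.adicCompletion ℚ]) hirr 1 0 ∧
         (ModPGaloisRep.IsTamelyRamified (FramedGaloisRep.restrictField (v.adicCompletion ℚ)
            (FramedRep.baseChange j continuous_of_discreteTopology ρ)) ∨
          ModPGaloisRep.IsPeuRamifie (FramedGaloisRep.restrictField (v.adicCompletion ℚ)
            (FramedRep.baseChange j continuous_of_discreteTopology ρ))))
      exact Or.inr ⟨hshape, Or.inr hpeu⟩
    rw [h2]; have := hp.out.two_le; omega
  · -- multiplicative, très ramifié: weight `p + 1`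
    have htres := (ModPGaloisRep.isTresRamifie_iff_not_isPeuRamifie _).mpr hpeu
    haveI := absMaximalIdeal_isMaximal_holds (v.adicCompletion ℚ)
    have hι : Function.Injective ι := by
      letI : Field (absIntegers 𝒪[v.adicCompletion ℚ] (v.adicCompletion ℚ) ⧸
        absMaximalIdeal (v.adicCompletion ℚ)) := Ideal.Quotient.field _
      exact ι.injective
    have h3 : serreWeight p (FramedRep.baseChange j continuous_of_discreteTopology ρ)
        { F := v.adicCompletion ℚ
          residueFieldCard_eq := residueFieldCard_adicCompletion_eq_of_natCast_mem hpv
          irreducible_natCast := irreducible_natCast_valuativeInteger_adicCompletion_of_natCast_mem hpv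
          rep := FramedGaloisRep.restrictField (v.adicCompletion ℚ)
            (FramedRep.baseChange j continuous_of_discreteTopology ρ)
          rep_eq_restrictField := rfl } ι = residueFieldCard (v.adicCompletion ℚ) + 1 := by
      change ModPGaloisRep.serreWeightLocal (FramedGaloisRep.restrictField (v.adicCompletion ℚ)
          (FramedRep.baseChange j continuous_of_discreteTopology ρ)) ι = _
      exact ModPGaloisRep.serreWeightLocal_eq_residueFieldCard_add_one_holds _ ι hι hq2 htres hirr
        hshape
    rw [h3, hq]

/-- **(ram) at `p ∈ {3, 5, 7}` for EVERY semistable curve with `E[p]` irreducible, whatever the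
reduction at `p`.**  `E/ℚ` semistable, `p` an odd prime `≤ 7`, `E[p]` irreducible ⇒ some `ℓ ‖ N`,
`ℓ ≠ p`, has `p ∤ ord_ℓ(Δ_min)`.  Ribet's level-lowering to level one, closed off by
`serreWeight_le_succ_of_semistable` (`k(ρ̄) ≤ p + 1 ≤ 8`) and `S_k(SL₂(ℤ)) = 0` for `k < 12`.
[cite: Ribet1990, Thm. 1.1] [cite: Diamond1995RefinedSerre, Thm. 1.1]
[cite: Serre1987, §2.4 (ii), §2.8 Prop. 3–4, §4.1 (4.1.12)] [cite: DiamondShurman2005, Thm. 3.5.2] -/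
theorem ram_of_semistable_of_irr_of_le_seven (hmod : exists_isNewformOf)
    (hLL : diamond1995_refinedSerre) (W : WeierstrassCurve ℚ) [W.IsElliptic] [W.IsGloballyMinimal]
    (p : ℕ) [Fact p.Prime] (hp2 : p ≠ 2) (hp7 : p ≤ 7) (hsst : Semistable W) (hirr : Irr W p) :
    Ram W p := by
  classical
  have hp : p.Prime := Fact.out
  have hodd : Odd p := hp.odd_of_ne_two hp2
  have hsstZ : W.IsSemistable ℤ := (semistable_iff_isSemistable_int W).mp hsst
  have hordZ : ∀ u : HeightOneSpectrum ℤ,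
      W.ordMinimalDiscriminant u = padicValInt (natGenerator u) W.minimalDiscriminantInt := by
    intro u
    rw [← W.factorization_minimalDiscriminantNorm_holds u,
      minimalDiscriminantNorm_int_eq_natAbs_minimalDiscriminantInt_holds W,
      Nat.factorization_def _ (show (natGenerator u).Prime from (primesEquiv u).2)]
    rfl
  by_contra hram
  have hunr : ∀ u : HeightOneSpectrum ℤ, natGenerator u ≠ p → W.HasMultiplicativeReductionAt u →
      p ∣ W.ordMinimalDiscriminant u := by
    intro u hup hmu
    by_contra hdiv
    apply hram
    refine ⟨natGenerator u, ⟨(primesEquiv u).2⟩, hup,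
      (hasMultiplicativeReductionAtPrime_primesEquiv_iff_hasMultiplicativeReductionAt W u).mpr hmu,
      ?_⟩
    rwa [hordZ u] at hdiv
  /- Step 1. A framed model `ρ̄` of `E[p]` and `ρ̄' = ρ̄ ⊗ 𝔽̄_p`: irreducible and odd. -/
  haveI : NeZero ((p : ℕ) : ℚ) := ⟨by exact_mod_cast hp.ne_zero⟩
  obtain ⟨ρ, hρ⟩ := W.exists_isTorsionGaloisRep p
  letI : TopologicalSpace (AlgebraicClosure (ZMod p)) := ⊥
  haveI : DiscreteTopology (AlgebraicClosure (ZMod p)) := ⟨rfl⟩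
  set j : ZMod p →+* AlgebraicClosure (ZMod p) := algebraMap (ZMod p) (AlgebraicClosure (ZMod p))
    with hj
  set ρ' : ModPGaloisRep ℚ (AlgebraicClosure (ZMod p)) 2 :=
    FramedRep.baseChange j continuous_of_discreteTopology ρ with hρ'
  have habs := isAbsolutelyIrreducible_of_hasIrreducibleModPGaloisRep W hp2 hirr hρ
  have hirr' : ρ'.toGaloisRep.IsIrreducible := by
    rw [← ModPGaloisRep.isIrreducible_iff_toGaloisRep]
    exact habs.isIrreducible_baseChange (AlgebraicClosure (ZMod p)) j _
  have hodd' : FramedGaloisRep.IsOdd ρ' :=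
    (ModPGaloisRep.isOdd_of_det_eq_modPCyclotomicCharacterZMod ρ
      (W.det_eq_modPCyclotomicCharacter_of_isTorsionGaloisRep_holds p ρ hρ)).baseChange j _
  /- Step 2. `ρ̄` and `ρ̄'` are modular. -/
  haveI : NeZero (W.conductorNorm ℤ) := ⟨(conductorNorm_pos_holds W).ne'⟩
  have hWmod : BCDT.IsModular W := exists_isNewformOf_iff.mp hmod W
  have hρmod : ModPGaloisRep.IsModular ρ := hWmod.isModular_of_isTorsionGaloisRep'' hρ
  have hρ'mod : ModPGaloisRep.IsModular ρ' := hρmod.baseChange_algebraicClosure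
  /- Step 3. The canonical local datum at the place above `p`; the weight is `≤ p + 1 ≤ 8`. -/
  obtain ⟨v, hv⟩ : ∃ v : HeightOneSpectrum (𝓞 ℚ), primesEquiv v = ⟨p, hp⟩ :=
    ⟨(primesEquiv (R := 𝓞 ℚ)).symm ⟨p, hp⟩, Equiv.apply_symm_apply _ _⟩
  have hpv' : (p : 𝓞 ℚ) ∈ v.asIdeal := (natCast_mem_asIdeal_iff_primesEquiv_eq v hp).mpr (by rw [hv])
  have hvs : v = (primesEquiv (R := 𝓞 ℚ)).symm ⟨p, hp⟩ := by
    rw [Equiv.eq_symm_apply]; exact hv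
  have hsemiv : W.HasGoodReductionAt v ∨ W.HasMultiplicativeReductionAt v := by
    rcases hsstZ ((primesEquiv (R := ℤ)).symm ⟨p, hp⟩) with hg | hm
    · exact Or.inl (by rw [hvs]; exact hasGoodReductionAt_of_int W ⟨p, hp⟩ hg)
    · exact Or.inr (by rw [hvs]; exact hasMultiplicativeReductionAt_of_int W ⟨p, hp⟩ hm)
  set loc : LocalRestrictionAt p ρ' :=
    { F := v.adicCompletion ℚ
      residueFieldCard_eq := residueFieldCard_adicCompletion_eq_of_natCast_mem hpv'
      irreducible_natCast := irreducible_natCast_valuativeInteger_adicCompletion_of_natCast_mem hpv'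
      rep := FramedGaloisRep.restrictField (v.adicCompletion ℚ) ρ'
      rep_eq_restrictField := rfl } with hloc
  obtain ⟨ι⟩ := nonempty_ringHom_residue (k := AlgebraicClosure (ZMod p)) p (v.adicCompletion ℚ)
    (residueFieldCard_adicCompletion_eq_of_natCast_mem hpv')
  have hwle : serreWeight p ρ' loc ι ≤ p + 1 :=
    serreWeight_le_succ_of_semistable W p hp2 v hpv' hsemiv hρ (AlgebraicClosure (ZMod p)) j ι
  have hw12 : ((serreWeight p ρ' loc ι : ℕ) : ℤ) < 12 := by omega
  /- Step 4. Level-lowering. -/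
  obtain ⟨M, hMz, hMN, f, ιf, hf, hgal⟩ :=
    hLL p hodd (AlgebraicClosure (ZMod p)) ρ' hirr' hodd' hρ'mod loc ι
  /- Step 5. `N(ρ̄') = 1`. -/
  have hN1 : serreLevel p ρ' = 1 := by
    refine Nat.eq_one_iff_not_exists_prime_dvd.mpr fun q hq hqN ↦ ?_
    rcases eq_or_ne q p with rfl | hqp
    · exact not_dvd_serreLevel q ρ' hqN
    · obtain ⟨u, hu⟩ : ∃ u : HeightOneSpectrum ℤ, natGenerator u = q :=
        ⟨(primesEquiv (R := ℤ)).symm ⟨q, hq⟩, Rat.natGenerator_primesEquiv_symm ⟨q, hq⟩⟩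
      rcases hsstZ u with hgu | hmu
      · exact not_dvd_serreLevel_baseChange_of_hasGoodReductionAt_int W p hρ j _ u
          (by rw [hu]; exact hqp) hgu (by rw [hu]; exact hqN)
      · exact not_dvd_serreLevel_baseChange_of_hasMultiplicativeReductionAt_of_dvd_int W p hρ j _ u
          (by rw [hu]; exact hqp) hmu (hunr u (by rw [hu]; exact hqp) hmu) (by rw [hu]; exact hqN)
  /- Step 6. `M = 1`, `S_k(Γ₁(1)) = 0` for `k < 12`, and a newform is nonzero. -/
  have hM1 : M = 1 := Nat.dvd_one.mp (hN1 ▸ hMN)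
  subst hM1
  exact IsNormalized.ne_zero hf.2.2.2 (cuspForm_gamma1_one_eq_zero_of_lt_twelve hw12 f)

end RibetSeven

end Literature.NumberTheory.EllipticCurves

end
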